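import Mathlib
import Summits.NavierStokesRegularity.NavierStokesRegularity.Theorems.LerayQuarterDissipationFiniteDissipationLiouvilleSmallDissipationGapBudget
import Literature.Analysis.FluidPDE.AncientSimilarityVorticity
import Literature.Analysis.FluidPDE.CurlFreeLiouville
import HarnessLib

/-!
# Small-dissipation gap for the finite-dissipation stratum, file 3/3: the Liouville theorem at small
  dissipation with an EXPLICIT threshold (crux `FiniteDissipationLiouville`, stmt-NavierStokesRegularity-22144,
  route `LerayQuarterDissipation`; a second, independent proof of the BC5 rung `stub_smallDissipationGap`,
  which the line lead landed first by a Duhamel/`L⁶`-modulo-constants argument in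
  `…FiniteDissipationLiouvilleStubSmallDissipationGap.lean`; seat ns-lqd-p2, helper)

HONEST FRAMING. A Liouville statement about a HYPOTHETICAL object — a Type-I ancient mild solution in
the Koch–Nadirashvili–Seregin–Šverák gauge (`IsTypeIAncientMild C V`: jointly smooth on `t < 0`,
divergence free, Oseen-mild between all pairs of negative times, `‖V(t,x)‖ ≤ C/√(−t)`) whose slices
obey the GLOBAL quarter-rate dissipation law `∫ ‖DV(t)‖² ≤ K/√(−t)`: IF
`√(max K 0) · (√K_S)³ ≤ 2/3` (`K_S = SNormLESNormFDerivOfEqConst ℝ³ volume 2`, Mathlib's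
Gagliardo–Nirenberg–Sobolev constant of `Ḣ¹(ℝ³) ⊂ L⁶`; e.g. `K ≤ 4/(9 (K_S + 1)³)`) THEN `V ≡ 0` on
`t < 0` (`eq_zero_of_small_dissipation`). This is the "first rung" (small-`K` members of the stratum
`𝒟`) of the route's crux with the threshold made explicit in the Sobolev constant alone; it says
nothing about larger `K`, nothing about the crux itself, and NOTHING about Navier–Stokes regularity or
blow-up. The Type-I constant `C` is arbitrary (it only enters the collar term, which is `O(1/R)`).

PROOF. Not the route card's `L⁶`-lifespan plan but the localised similarity-enstrophy budget of the
tree's T31⁗ files (`…SimilarityEnstrophyCutoffBudget/TimeOnlyThreshold`, where the threshold came from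
the Type-I constant) with the stretching term priced by the dissipation constant instead:
(1) scale invariance — the law gives `∫ ‖DU(s)‖² ≤ max K 0` for every similarity slice
`U(s) = lerayOrbit V s` (`integrable_sq_norm_fderiv_lerayOrbit`), hence `∫‖Ω(s)‖² ≤ ‖curlCLM‖² max K 0`;
(2) file 2/3 (`…SmallDissipationGapBudget`): for `√(max K 0)·(√K_S)³ ≤ 2/3` the squared-cutoff
enstrophy `Z_R = ∫φ_R²‖Ω‖²` obeys `Z_R' ≤ −(1/6)Z_R + (L/R)∫_{B̄_{2R}}‖Ω‖² ≤ −(1/6)Z_R + LM/R`;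
(3) the orbit is ANCIENT in `s`, so the backward ODE bound (`le_div_of_deriv_le_neg_mul_add`) gives
`∫_{B̄_R}‖Ω(s)‖² ≤ Z_R(s) ≤ 6LM/R`, and `R → ∞` (`tendsto_setIntegral_of_monotone`) gives
`∫‖Ω(s)‖² = 0`, `Ω ≡ 0`; (4) curl-free + divergence-free + bounded slices are constant
(`eq_of_curl_eq_zero_of_isDivFree_of_bounded`) and the Oseen gauge kills constants
(`IsTypeIAncientMild.eq_zero_of_slice_const`). [folklore energy method; Ladyzhenskaya's inequality;
KNSS 2009 Remark 6.1 for the gauge]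
-/

noncomputable section

set_option linter.dupNamespace false

namespace Summit.NavierStokesRegularity.NavierStokesRegularity.Theorems.SmallDissipationGap

open MeasureTheory Set Filter Topology Metric InnerProductSpace Function Real
open scoped RealInnerProductSpace Laplacian ContDiff
open Literature.Analysis Literature.Analysis.FluidPDE
open Summit.NavierStokesRegularity.NavierStokesRegularity.Theorems
open Summit.NavierStokesRegularity.NavierStokesRegularity.Theorems.GaussianGap
open Summit.NavierStokesRegularity.NavierStokesRegularity.Theorems.SimilarityEnstrophy

variable {C : ℝ} {V : ℝ → (EuclideanSpace ℝ (Fin 3)) → (EuclideanSpace ℝ (Fin 3))}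

/-! ### From the quarter-rate dissipation law to the similarity slices (scale invariance) -/

section Scaling

/-- **Scale invariance of the dissipation law.** If the physical slices obey
`∫ ‖DV(t)‖² ≤ K/√(−t)` (`t < 0`), then every similarity slice `U(s) = lerayOrbit V s` has
`‖DU(s)‖² ∈ L¹` with `∫ ‖DU(s)‖² ≤ max K 0`: `DU(s)(y) = e^{−s} DV(t)(e^{−s/2}y)`, `t = −e^{−s}`, and
`∫ ‖DV(t)(e^{−s/2}y)‖² dy = e^{3s/2} ∫‖DV(t)‖²`. [folklore; Leray 1934 §20 (scaling)] -/
theorem integrable_sq_norm_fderiv_lerayOrbit (hV : IsTypeIAncientMild C V) {K : ℝ}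
    (hK : ∀ t : ℝ, t < 0 → ∫⁻ x, ‖fderiv ℝ (V t) x‖ₑ ^ 2 ≤ ENNReal.ofReal (K / Real.sqrt (-t)))
    (s : ℝ) :
    Integrable (fun y => ‖fderiv ℝ (lerayOrbit V s) y‖ ^ 2) ∧
      ∫ y, ‖fderiv ℝ (lerayOrbit V s) y‖ ^ 2 ≤ max K 0 := by
  set t : ℝ := -Real.exp (-s) with htdef
  set c : ℝ := Real.exp (-s / 2) with hcdef
  have ht : t < 0 := neg_neg_of_pos (Real.exp_pos _)
  have hc : 0 < c := Real.exp_pos _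
  have hsqrt : Real.sqrt (-t) = c := by rw [htdef, neg_neg, sqrt_exp_neg]
  have hK0 : 0 ≤ max K 0 := le_max_right _ _
  -- the physical slice
  have h1 : ContDiff ℝ 1 (V t) := (hV.contDiff_slice ht).of_le (by norm_cast)
  have hcont : Continuous (fderiv ℝ (V t)) := h1.continuous_fderiv one_ne_zero
  have hbd : ∫⁻ x, ‖fderiv ℝ (V t) x‖ₑ ^ 2 ≤ ENNReal.ofReal (max K 0 / Real.sqrt (-t)) :=
    (hK t ht).trans (ENNReal.ofReal_le_ofReal
      (div_le_div_of_nonneg_right (le_max_left _ _) (Real.sqrt_nonneg _)))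
  have hintV : Integrable fun x => ‖fderiv ℝ (V t) x‖ ^ 2 :=
    integrable_sq_norm_of_lintegral_lt_top hcont (lt_of_le_of_lt hbd ENNReal.ofReal_lt_top)
  have hvalV : ∫ x, ‖fderiv ℝ (V t) x‖ ^ 2 ≤ max K 0 / c := by
    rw [← hsqrt]
    refine (ENNReal.ofReal_le_ofReal_iff (by positivity)).1 ?_
    rw [ofReal_integral_sq_norm hintV]
    exact hbd
  -- the similarity slice
  have hrepr : ∀ y, ‖fderiv ℝ (lerayOrbit V s) y‖ ^ 2 =
      Real.exp (-s) ^ 2 * ‖fderiv ℝ (V t) (c • y)‖ ^ 2 := by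
    intro y
    rw [fderiv_lerayOrbit_eq_lerayOrbitVorticity, lerayOrbitVorticity_apply, norm_smul,
      Real.norm_of_nonneg (Real.exp_pos _).le, mul_pow]
  have hfun : (fun y => ‖fderiv ℝ (lerayOrbit V s) y‖ ^ 2) =
      fun y => Real.exp (-s) ^ 2 * (fun x => ‖fderiv ℝ (V t) x‖ ^ 2) (c • y) := funext hrepr
  have hintc : Integrable fun y => (fun x => ‖fderiv ℝ (V t) x‖ ^ 2) (c • y) :=
    (integrable_comp_smul_iff (volume : Measure (EuclideanSpace ℝ (Fin 3)))
      (fun x => ‖fderiv ℝ (V t) x‖ ^ 2) hc.ne').2 hintV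
  refine ⟨by rw [hfun]; exact hintc.const_mul _, ?_⟩
  have hsc : (∫ y, (fun x => ‖fderiv ℝ (V t) x‖ ^ 2) (c • y)) =
      |(c ^ 3)⁻¹| • ∫ x, ‖fderiv ℝ (V t) x‖ ^ 2 := by
    have h := Measure.integral_comp_smul (volume : Measure (EuclideanSpace ℝ (Fin 3)))
      (fun x => ‖fderiv ℝ (V t) x‖ ^ 2) c
    rw [finrank_euclideanSpace_fin] at h
    exact h
  rw [hfun, integral_const_mul, hsc, smul_eq_mul, abs_of_nonneg (by positivity)]
  have hc3 : Real.exp (-s) ^ 2 * (c ^ 3)⁻¹ = c := by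
    have e2 : Real.exp (-s) = c * c := by rw [hcdef, ← Real.exp_add]; congr 1; ring
    rw [e2]; field_simp
  calc Real.exp (-s) ^ 2 * ((c ^ 3)⁻¹ * ∫ x, ‖fderiv ℝ (V t) x‖ ^ 2)
      = c * ∫ x, ‖fderiv ℝ (V t) x‖ ^ 2 := by rw [← mul_assoc, hc3]
    _ ≤ c * (max K 0 / c) := mul_le_mul_of_nonneg_left hvalV hc.le
    _ = max K 0 := by field_simp

/-- **Global enstrophy of the similarity slices.** Under the dissipation law the similarity vorticity
`Ω(s) = curl U(s)` has `∫ ‖Ω(s)‖² ≤ ‖curlCLM‖² · max K 0` for every `s` (`|curl U| ≤ ‖curlCLM‖ ‖DU‖`).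
[folklore] -/
theorem integrable_sq_norm_lerayVorticity (hV : IsTypeIAncientMild C V) {K : ℝ}
    (hK : ∀ t : ℝ, t < 0 → ∫⁻ x, ‖fderiv ℝ (V t) x‖ₑ ^ 2 ≤ ENNReal.ofReal (K / Real.sqrt (-t)))
    (s : ℝ) :
    Integrable (fun y => ‖lerayVorticity V s y‖ ^ 2) ∧
      ∫ y, ‖lerayVorticity V s y‖ ^ 2 ≤ ‖curlCLM‖ ^ 2 * max K 0 := by
  obtain ⟨hint, hle⟩ := integrable_sq_norm_fderiv_lerayOrbit hV hK s
  have hcΩ : Continuous (lerayVorticity V s) :=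
    (signedBudget_contDiff_lerayVorticity_slice hV s (n := 1)).continuous
  have hpt : ∀ y, ‖lerayVorticity V s y‖ ^ 2 ≤ ‖curlCLM‖ ^ 2 * ‖fderiv ℝ (lerayOrbit V s) y‖ ^ 2 := by
    intro y
    rw [lerayVorticity_apply, ← mul_pow]
    exact pow_le_pow_left₀ (norm_nonneg _) (norm_curl_le _ y) 2
  have hintΩ : Integrable fun y => ‖lerayVorticity V s y‖ ^ 2 :=
    (hint.const_mul (‖curlCLM‖ ^ 2)).mono' (hcΩ.norm.pow 2).aestronglyMeasurable
      (Eventually.of_forall fun y => by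
        rw [Real.norm_of_nonneg (sq_nonneg _)]; exact hpt y)
  refine ⟨hintΩ, ?_⟩
  calc ∫ y, ‖lerayVorticity V s y‖ ^ 2 ≤ ∫ y, ‖curlCLM‖ ^ 2 * ‖fderiv ℝ (lerayOrbit V s) y‖ ^ 2 :=
        integral_mono hintΩ (hint.const_mul _) hpt
    _ = ‖curlCLM‖ ^ 2 * ∫ y, ‖fderiv ℝ (lerayOrbit V s) y‖ ^ 2 := integral_const_mul _ _
    _ ≤ ‖curlCLM‖ ^ 2 * max K 0 := mul_le_mul_of_nonneg_left hle (sq_nonneg _)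

end Scaling

/-! ### The gap: small dissipation forces `Ω ≡ 0`, hence `V ≡ 0` -/

section Gap

/-- **The similarity vorticity vanishes when the dissipation constant is small.** For a KNSS-gauge
Type-I field `V` with the dissipation law `∫‖DV(t)‖² ≤ K/√(−t)` and
`√(max K 0) · (√K_S)³ ≤ 2/3`: `Ω ≡ 0`. The budget `Z_R' ≤ −(1/6)Z_R + (L/R)·M`
(`deriv_sqCutoffEnstrophy_le`, `M = ‖curlCLM‖² max K 0 ≥ ∫_{B̄_{2R}}‖Ω‖²`) and the backward ODE bound
for the ANCIENT orbit (`le_div_of_deriv_le_neg_mul_add`) give `∫_{B̄_R}‖Ω(s)‖² ≤ Z_R(s) ≤ 6LM/R`;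
`R → ∞` gives `∫‖Ω(s)‖² = 0`. [folklore energy method] -/
theorem lerayVorticity_eq_zero_of_small_dissipation (hV : IsTypeIAncientMild C V) {K : ℝ}
    (hK : ∀ t : ℝ, t < 0 → ∫⁻ x, ‖fderiv ℝ (V t) x‖ₑ ^ 2 ≤ ENNReal.ofReal (K / Real.sqrt (-t)))
    (hθ : Real.sqrt (max K 0) *
      Real.sqrt (SNormLESNormFDerivOfEqConst (EuclideanSpace ℝ (Fin 3))
        (volume : Measure (EuclideanSpace ℝ (Fin 3))) 2 : ℝ) ^ 3 ≤ 2 / 3) :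
    ∀ s y, lerayVorticity V s y = 0 := by
  have hDU := fun s => integrable_sq_norm_fderiv_lerayOrbit hV hK s
  have hΩ := fun s => integrable_sq_norm_lerayVorticity hV hK s
  obtain ⟨L, hL0, hL⟩ := deriv_sqCutoffEnstrophy_le hV (KU := max K 0) (fun s => (hDU s).1)
    (fun s => (hDU s).2) hθ
  set M : ℝ := ‖curlCLM‖ ^ 2 * max K 0 with hMdef
  have hM0 : 0 ≤ M := by positivity
  -- Step 1: `Z_R(s) ≤ 6 L M / R` for every `R ≥ 1` and every `s`
  have hZ : ∀ R : ℝ, 1 ≤ R → ∀ s : ℝ,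
      (∫ y, smoothTransition (2 - ‖y‖ ^ 2 / R ^ 2) ^ 2 * ‖lerayVorticity V s y‖ ^ 2) ≤
        (L / R * M) / (1 / 6) := by
    intro R hR1
    have hR : 0 < R := lt_of_lt_of_le one_pos hR1
    have hd : Differentiable ℝ fun σ =>
        ∫ y, smoothTransition (2 - ‖y‖ ^ 2 / R ^ 2) ^ 2 * ‖lerayVorticity V σ y‖ ^ 2 :=
      fun σ => (hasDerivAt_sqCutoffEnstrophy hV hR σ).differentiableAt
    have hle : ∀ σ, (∫ y, smoothTransition (2 - ‖y‖ ^ 2 / R ^ 2) ^ 2 * ‖lerayVorticity V σ y‖ ^ 2) ≤ M := by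
      intro σ
      calc (∫ y, smoothTransition (2 - ‖y‖ ^ 2 / R ^ 2) ^ 2 * ‖lerayVorticity V σ y‖ ^ 2)
          ≤ ∫ y, ‖lerayVorticity V σ y‖ ^ 2 := by
            refine integral_mono_of_nonneg (Eventually.of_forall fun y =>
              mul_nonneg (sq_nonneg _) (sq_nonneg _)) (hΩ σ).1 (Eventually.of_forall fun y => ?_)
            have h1 := sqCutoff_le_one R y
            have h0 : 0 ≤ ‖lerayVorticity V σ y‖ ^ 2 := sq_nonneg _
            nlinarith
        _ ≤ M := (hΩ σ).2
    have hI : ∀ σ, (∫ y in closedBall (0 : EuclideanSpace ℝ (Fin 3)) (2 * R), ‖lerayVorticity V σ y‖ ^ 2) ≤ M :=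
      fun σ => (setIntegral_le_integral (hΩ σ).1 (Eventually.of_forall fun y => sq_nonneg _)).trans (hΩ σ).2
    have hZ' : ∀ σ, deriv (fun σ' =>
        ∫ y, smoothTransition (2 - ‖y‖ ^ 2 / R ^ 2) ^ 2 * ‖lerayVorticity V σ' y‖ ^ 2) σ ≤
        -(1 / 6) * (∫ y, smoothTransition (2 - ‖y‖ ^ 2 / R ^ 2) ^ 2 * ‖lerayVorticity V σ y‖ ^ 2) +
          L / R * M := by
      intro σ
      refine (hL R hR1 σ).trans ?_
      have := mul_le_mul_of_nonneg_left (hI σ) (div_nonneg hL0 hR.le)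
      linarith
    exact le_div_of_deriv_le_neg_mul_add hd ⟨M, hle⟩ (by norm_num : (0:ℝ) < 1 / 6) hZ'
  -- Step 2: `∫_{B̄_n} ‖Ω(s)‖² ≤ 6 L M / n`, and the limit `n → ∞`
  intro s
  have hcΩ : Continuous (lerayVorticity V s) :=
    (signedBudget_contDiff_lerayVorticity_slice hV s (n := 1)).continuous
  have hball : ∀ n : ℕ, 1 ≤ (n : ℝ) →
      (∫ y in closedBall (0 : EuclideanSpace ℝ (Fin 3)) n, ‖lerayVorticity V s y‖ ^ 2) ≤
        (L / n * M) / (1 / 6) := by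
    intro n hn
    have hR : 0 < (n : ℝ) := lt_of_lt_of_le one_pos hn
    refine le_trans ?_ (hZ n hn s)
    have hint : Integrable fun y => smoothTransition (2 - ‖y‖ ^ 2 / (n : ℝ) ^ 2) ^ 2 *
        ‖lerayVorticity V s y‖ ^ 2 :=
      (((contDiff_sqCutoff (n := 1) (n : ℝ)).continuous).mul (hcΩ.norm.pow 2)).integrable_of_hasCompactSupport
        ((hasCompactSupport_sqCutoff hR).mul_right)
    calc (∫ y in closedBall (0 : EuclideanSpace ℝ (Fin 3)) n, ‖lerayVorticity V s y‖ ^ 2)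
        = ∫ y in closedBall (0 : EuclideanSpace ℝ (Fin 3)) n,
            smoothTransition (2 - ‖y‖ ^ 2 / (n : ℝ) ^ 2) ^ 2 * ‖lerayVorticity V s y‖ ^ 2 := by
          refine setIntegral_congr_fun measurableSet_closedBall fun y hy => ?_
          rw [mem_closedBall, dist_zero_right] at hy
          rw [sqCutoff_eq_one hR hy, one_mul]
      _ ≤ ∫ y, smoothTransition (2 - ‖y‖ ^ 2 / (n : ℝ) ^ 2) ^ 2 * ‖lerayVorticity V s y‖ ^ 2 :=
          setIntegral_le_integral hint (Eventually.of_forall fun y =>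
            mul_nonneg (sq_nonneg _) (sq_nonneg _))
  have hlim : Tendsto (fun n : ℕ =>
      ∫ y in closedBall (0 : EuclideanSpace ℝ (Fin 3)) n, ‖lerayVorticity V s y‖ ^ 2) atTop
      (𝓝 (∫ y, ‖lerayVorticity V s y‖ ^ 2)) := by
    have h := tendsto_setIntegral_of_monotone (μ := (volume : Measure (EuclideanSpace ℝ (Fin 3))))
      (s := fun n : ℕ => closedBall (0 : EuclideanSpace ℝ (Fin 3)) n)
      (f := fun y => ‖lerayVorticity V s y‖ ^ 2) (fun n => measurableSet_closedBall)
      (fun m n hmn => closedBall_subset_closedBall (by exact_mod_cast hmn))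
      (by rw [iUnion_closedBall_nat]; exact (hΩ s).1.integrableOn)
    rwa [iUnion_closedBall_nat, Measure.restrict_univ] at h
  have hlim0 : Tendsto (fun n : ℕ => (L / n * M) / (1 / 6)) atTop (𝓝 0) := by
    have h := tendsto_const_div_atTop_nhds_zero_nat (6 * L * M)
    refine h.congr fun n => ?_
    ring
  have hE0 : ∫ y, ‖lerayVorticity V s y‖ ^ 2 ≤ 0 :=
    le_of_tendsto_of_tendsto hlim hlim0 (Filter.eventually_atTop.2 ⟨1, fun n hn => hball n
      (by exact_mod_cast hn)⟩)
  have hE : ∫ y, ‖lerayVorticity V s y‖ ^ 2 = 0 :=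
    le_antisymm hE0 (integral_nonneg fun y => sq_nonneg _)
  have hae : (fun y => ‖lerayVorticity V s y‖ ^ 2) =ᵐ[volume] 0 :=
    (integral_eq_zero_iff_of_nonneg (fun y => sq_nonneg _) (hΩ s).1).1 hE
  have hev : (fun y => ‖lerayVorticity V s y‖ ^ 2) = fun _ => (0 : ℝ) :=
    ((hcΩ.norm.pow 2).ae_eq_iff_eq (μ := volume) continuous_const).1 hae
  intro y
  have hy := congrFun hev y
  have : ‖lerayVorticity V s y‖ = 0 := pow_eq_zero_iff (n := 2) (by norm_num) |>.1 hy
  exact norm_eq_zero.1 this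

/-- **The small-dissipation Liouville theorem for the finite-dissipation stratum.** A Type-I ancient
mild solution in the KNSS gauge whose slices obey the quarter-rate dissipation law
`∫‖DV(t)‖² ≤ K/√(−t)` with `√(max K 0)·(√K_S)³ ≤ 2/3` vanishes identically on `t < 0`:
`Ω ≡ 0` (`lerayVorticity_eq_zero_of_small_dissipation`), so every slice is curl- and divergence-free
and bounded, hence constant (`eq_of_curl_eq_zero_of_isDivFree_of_bounded`), and the Oseen gauge kills
spatially constant slices (`IsTypeIAncientMild.eq_zero_of_slice_const`). HONEST FRAMING: a Liouville
statement about a HYPOTHETICAL class; nothing here bears on NS regularity. [folklore energy method] -/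
theorem eq_zero_of_small_dissipation (hV : IsTypeIAncientMild C V) {K : ℝ}
    (hK : ∀ t : ℝ, t < 0 → ∫⁻ x, ‖fderiv ℝ (V t) x‖ₑ ^ 2 ≤ ENNReal.ofReal (K / Real.sqrt (-t)))
    (hθ : Real.sqrt (max K 0) *
      Real.sqrt (SNormLESNormFDerivOfEqConst (EuclideanSpace ℝ (Fin 3))
        (volume : Measure (EuclideanSpace ℝ (Fin 3))) 2 : ℝ) ^ 3 ≤ 2 / 3) :
    ∀ t < 0, ∀ x, V t x = 0 := by
  have hΩ0 := lerayVorticity_eq_zero_of_small_dissipation hV hK hθ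
  have hcurl : ∀ t < 0, ∀ x, curl (V t) x = 0 := by
    intro t ht x
    set s : ℝ := -Real.log (-t) with hs
    have hts : -Real.exp (-s) = t := by
      rw [hs, neg_neg, Real.exp_log (neg_pos.2 ht), neg_neg]
    have h := hΩ0 s ((Real.exp (-s / 2))⁻¹ • x)
    rw [lerayVorticity_apply, curl_lerayOrbit, smul_smul,
      mul_inv_cancel₀ (Real.exp_pos _).ne', one_smul, hts, smul_eq_zero] at h
    exact h.resolve_left (Real.exp_pos _).ne'
  have hconst : ∀ t < 0, ∀ x, V t x = V t 0 := fun t ht x =>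
    eq_of_curl_eq_zero_of_isDivFree_of_bounded ((hV.contDiff_slice ht).of_le (by norm_cast))
      (hcurl t ht) (hV.isDivFree ht) (fun z => hV.norm_le ht z) x 0
  exact fun t ht x => hV.eq_zero_of_slice_const (b := fun t => V t 0) hconst ht x

end Gap

end Summit.NavierStokesRegularity.NavierStokesRegularity.Theorems.SmallDissipationGap

end
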